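import Summits.MatrixMultiplication.OmegaCensus.DihedralLawModOneOrder25
import HarnessLib

/-!
# Named instances of the generic `3p + 1` / `6p + 1` law exclusions: `|A| = 175, 250, 475, 490, 700, 850`

ω-census `pub-omega`, family (b3), seat pub-omega-group gen 38.  Framing: lottery ticket; floor = certified bounds/negative ranges.
VALUE: named kernel instances (one line each) of `no_mod_one_law_of_small_orders_prime` (`|A| = 3p + 1`: cube shapes `(1,1,p)` only) and
`no_law_card_six_prime_add_one_of_small_orders` (`|A| = 6p + 1`: shapes `(1,1,2p)`, `(1,2,p)`) for the non-cyclic abelian groups of orders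
`175 = 6·29+1` (`ℤ₅ × ℤ₃₅`), `250 = 3·83+1` (`ℤ₅ × ℤ₅₀`), `475 = 6·79+1` (`ℤ₅ × ℤ₉₅`), `490 = 3·163+1` (`ℤ₇ × ℤ₇₀`), `700 = 3·233+1`
(`ℤ₅ × ℤ₁₄₀`, `ℤ₁₀ × ℤ₇₀`), `850 = 3·283+1` (`ℤ₅ × ℤ₁₇₀`) without an element of order `≥ |A|/2` — so that, together with
`DihedralLawModOneZ5Z5Orders*.lean`, `DihedralLawModOneZ7Z7Orders*.lean`, `DihedralLawModOneOrder325/625.lean`, every order `≤ 1000` with a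
`ℤ₅²` or `ℤ₇²` quotient whose census cells are all kernel has one named theorem per group; NOT progress on ω.
-/

namespace Summit.MatrixMultiplication.OmegaCensus

open Literature.Combinatorics.Additive Finset

section Instances

variable {G : Type} [Group G] [DecidableEq G] {S T U : Finset G}

/-- Every element of `ℤ₅ × ℤ₃₅` has order `≤ 35 < |A|/2`. [folklore] -/
theorem two_mul_addOrderOf_lt_z5_z35 (g : ZMod 5 × ZMod 35) : 2 * addOrderOf g < Fintype.card (ZMod 5 × ZMod 35) := by
  have h1 : addOrderOf g.1 ∣ 35 := (addOrderOf_dvd_card (x := g.1)).trans (by rw [ZMod.card]; norm_num)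
  have h2 : addOrderOf g.2 ∣ 35 := (addOrderOf_dvd_card (x := g.2)).trans (by rw [ZMod.card])
  have hle : addOrderOf g ≤ 35 := Nat.le_of_dvd (by norm_num) (by rw [Prod.addOrderOf]; exact Nat.lcm_dvd h1 h2)
  have hA : Fintype.card (ZMod 5 × ZMod 35) = 175 := by simp [Fintype.card_prod, ZMod.card]
  omega

/-- **`ℤ₅ × ℤ₃₅` (`|A| = 175`, = 6·29 + 1): no dihedral-like group over it (any `c₀`) has a TPP triple attaining
`3|S||T||U| + 8 = 8|A|`.** [folklore] -/
theorem no_mod_one_law_z5_z35 {ρ τ : ZMod 5 × ZMod 35 → G} {c₀ : ZMod 5 × ZMod 35}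
    (hρρ : ∀ a b, ρ a * ρ b = ρ (a + b)) (hρτ : ∀ a b, ρ a * τ b = τ (b - a))
    (hτρ : ∀ a b, τ a * ρ b = τ (a + b)) (hττ : ∀ a b, τ a * τ b = ρ (c₀ + b - a))
    (hρ : Function.Injective ρ) (hτ : Function.Injective τ) (hne : ∀ a b, ρ a ≠ τ b)
    (hsurj : ∀ g, (∃ a, ρ a = g) ∨ (∃ a, τ a = g)) (h : TripleProductProperty S T U) :
    3 * (S.card * T.card * U.card) + 8 ≠ 8 * Fintype.card (ZMod 5 × ZMod 35) :=
  no_law_card_six_prime_add_one_of_small_orders hρρ hρτ hτρ hττ hρ hτ hne hsurj (p := 29) (by norm_num) (by norm_num)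
    (by simp [Fintype.card_prod, ZMod.card]) two_mul_addOrderOf_lt_z5_z35 h

/-- Every element of `ℤ₅ × ℤ₅₀` has order `≤ 50 < |A|/2`. [folklore] -/
theorem two_mul_addOrderOf_lt_z5_z50 (g : ZMod 5 × ZMod 50) : 2 * addOrderOf g < Fintype.card (ZMod 5 × ZMod 50) := by
  have h1 : addOrderOf g.1 ∣ 50 := (addOrderOf_dvd_card (x := g.1)).trans (by rw [ZMod.card]; norm_num)
  have h2 : addOrderOf g.2 ∣ 50 := (addOrderOf_dvd_card (x := g.2)).trans (by rw [ZMod.card])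
  have hle : addOrderOf g ≤ 50 := Nat.le_of_dvd (by norm_num) (by rw [Prod.addOrderOf]; exact Nat.lcm_dvd h1 h2)
  have hA : Fintype.card (ZMod 5 × ZMod 50) = 250 := by simp [Fintype.card_prod, ZMod.card]
  omega

/-- **`ℤ₅ × ℤ₅₀` (`|A| = 250`, = 3·83 + 1): no dihedral-like group over it (any `c₀`) has a TPP triple attaining
`3|S||T||U| + 8 = 8|A|`.** [folklore] -/
theorem no_mod_one_law_z5_z50 {ρ τ : ZMod 5 × ZMod 50 → G} {c₀ : ZMod 5 × ZMod 50}
    (hρρ : ∀ a b, ρ a * ρ b = ρ (a + b)) (hρτ : ∀ a b, ρ a * τ b = τ (b - a))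
    (hτρ : ∀ a b, τ a * ρ b = τ (a + b)) (hττ : ∀ a b, τ a * τ b = ρ (c₀ + b - a))
    (hρ : Function.Injective ρ) (hτ : Function.Injective τ) (hne : ∀ a b, ρ a ≠ τ b)
    (hsurj : ∀ g, (∃ a, ρ a = g) ∨ (∃ a, τ a = g)) (h : TripleProductProperty S T U) :
    3 * (S.card * T.card * U.card) + 8 ≠ 8 * Fintype.card (ZMod 5 × ZMod 50) :=
  no_mod_one_law_of_small_orders_prime (p := 83) (by norm_num) hρρ hρτ hτρ hττ hρ hτ hne hsurj (by simp [Fintype.card_prod, ZMod.card])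
    (by simp [Fintype.card_prod, ZMod.card]) two_mul_addOrderOf_lt_z5_z50 h

/-- Every element of `ℤ₅ × ℤ₉₅` has order `≤ 95 < |A|/2`. [folklore] -/
theorem two_mul_addOrderOf_lt_z5_z95 (g : ZMod 5 × ZMod 95) : 2 * addOrderOf g < Fintype.card (ZMod 5 × ZMod 95) := by
  have h1 : addOrderOf g.1 ∣ 95 := (addOrderOf_dvd_card (x := g.1)).trans (by rw [ZMod.card]; norm_num)
  have h2 : addOrderOf g.2 ∣ 95 := (addOrderOf_dvd_card (x := g.2)).trans (by rw [ZMod.card])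
  have hle : addOrderOf g ≤ 95 := Nat.le_of_dvd (by norm_num) (by rw [Prod.addOrderOf]; exact Nat.lcm_dvd h1 h2)
  have hA : Fintype.card (ZMod 5 × ZMod 95) = 475 := by simp [Fintype.card_prod, ZMod.card]
  omega

/-- **`ℤ₅ × ℤ₉₅` (`|A| = 475`, = 6·79 + 1): no dihedral-like group over it (any `c₀`) has a TPP triple attaining
`3|S||T||U| + 8 = 8|A|`.** [folklore] -/
theorem no_mod_one_law_z5_z95 {ρ τ : ZMod 5 × ZMod 95 → G} {c₀ : ZMod 5 × ZMod 95}
    (hρρ : ∀ a b, ρ a * ρ b = ρ (a + b)) (hρτ : ∀ a b, ρ a * τ b = τ (b - a))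
    (hτρ : ∀ a b, τ a * ρ b = τ (a + b)) (hττ : ∀ a b, τ a * τ b = ρ (c₀ + b - a))
    (hρ : Function.Injective ρ) (hτ : Function.Injective τ) (hne : ∀ a b, ρ a ≠ τ b)
    (hsurj : ∀ g, (∃ a, ρ a = g) ∨ (∃ a, τ a = g)) (h : TripleProductProperty S T U) :
    3 * (S.card * T.card * U.card) + 8 ≠ 8 * Fintype.card (ZMod 5 × ZMod 95) :=
  no_law_card_six_prime_add_one_of_small_orders hρρ hρτ hτρ hττ hρ hτ hne hsurj (p := 79) (by norm_num) (by norm_num)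
    (by simp [Fintype.card_prod, ZMod.card]) two_mul_addOrderOf_lt_z5_z95 h

/-- Every element of `ℤ₇ × ℤ₇₀` has order `≤ 70 < |A|/2`. [folklore] -/
theorem two_mul_addOrderOf_lt_z7_z70 (g : ZMod 7 × ZMod 70) : 2 * addOrderOf g < Fintype.card (ZMod 7 × ZMod 70) := by
  have h1 : addOrderOf g.1 ∣ 70 := (addOrderOf_dvd_card (x := g.1)).trans (by rw [ZMod.card]; norm_num)
  have h2 : addOrderOf g.2 ∣ 70 := (addOrderOf_dvd_card (x := g.2)).trans (by rw [ZMod.card])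
  have hle : addOrderOf g ≤ 70 := Nat.le_of_dvd (by norm_num) (by rw [Prod.addOrderOf]; exact Nat.lcm_dvd h1 h2)
  have hA : Fintype.card (ZMod 7 × ZMod 70) = 490 := by simp [Fintype.card_prod, ZMod.card]
  omega

/-- **`ℤ₇ × ℤ₇₀` (`|A| = 490`, = 3·163 + 1): no dihedral-like group over it (any `c₀`) has a TPP triple attaining
`3|S||T||U| + 8 = 8|A|`.** [folklore] -/
theorem no_mod_one_law_z7_z70 {ρ τ : ZMod 7 × ZMod 70 → G} {c₀ : ZMod 7 × ZMod 70}
    (hρρ : ∀ a b, ρ a * ρ b = ρ (a + b)) (hρτ : ∀ a b, ρ a * τ b = τ (b - a))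
    (hτρ : ∀ a b, τ a * ρ b = τ (a + b)) (hττ : ∀ a b, τ a * τ b = ρ (c₀ + b - a))
    (hρ : Function.Injective ρ) (hτ : Function.Injective τ) (hne : ∀ a b, ρ a ≠ τ b)
    (hsurj : ∀ g, (∃ a, ρ a = g) ∨ (∃ a, τ a = g)) (h : TripleProductProperty S T U) :
    3 * (S.card * T.card * U.card) + 8 ≠ 8 * Fintype.card (ZMod 7 × ZMod 70) :=
  no_mod_one_law_of_small_orders_prime (p := 163) (by norm_num) hρρ hρτ hτρ hττ hρ hτ hne hsurj (by simp [Fintype.card_prod, ZMod.card])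
    (by simp [Fintype.card_prod, ZMod.card]) two_mul_addOrderOf_lt_z7_z70 h

/-- Every element of `ℤ₅ × ℤ₁₄₀` has order `≤ 140 < |A|/2`. [folklore] -/
theorem two_mul_addOrderOf_lt_z5_z140 (g : ZMod 5 × ZMod 140) : 2 * addOrderOf g < Fintype.card (ZMod 5 × ZMod 140) := by
  have h1 : addOrderOf g.1 ∣ 140 := (addOrderOf_dvd_card (x := g.1)).trans (by rw [ZMod.card]; norm_num)
  have h2 : addOrderOf g.2 ∣ 140 := (addOrderOf_dvd_card (x := g.2)).trans (by rw [ZMod.card])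
  have hle : addOrderOf g ≤ 140 := Nat.le_of_dvd (by norm_num) (by rw [Prod.addOrderOf]; exact Nat.lcm_dvd h1 h2)
  have hA : Fintype.card (ZMod 5 × ZMod 140) = 700 := by simp [Fintype.card_prod, ZMod.card]
  omega

/-- **`ℤ₅ × ℤ₁₄₀` (`|A| = 700`, = 3·233 + 1): no dihedral-like group over it (any `c₀`) has a TPP triple attaining
`3|S||T||U| + 8 = 8|A|`.** [folklore] -/
theorem no_mod_one_law_z5_z140 {ρ τ : ZMod 5 × ZMod 140 → G} {c₀ : ZMod 5 × ZMod 140}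
    (hρρ : ∀ a b, ρ a * ρ b = ρ (a + b)) (hρτ : ∀ a b, ρ a * τ b = τ (b - a))
    (hτρ : ∀ a b, τ a * ρ b = τ (a + b)) (hττ : ∀ a b, τ a * τ b = ρ (c₀ + b - a))
    (hρ : Function.Injective ρ) (hτ : Function.Injective τ) (hne : ∀ a b, ρ a ≠ τ b)
    (hsurj : ∀ g, (∃ a, ρ a = g) ∨ (∃ a, τ a = g)) (h : TripleProductProperty S T U) :
    3 * (S.card * T.card * U.card) + 8 ≠ 8 * Fintype.card (ZMod 5 × ZMod 140) :=
  no_mod_one_law_of_small_orders_prime (p := 233) (by norm_num) hρρ hρτ hτρ hττ hρ hτ hne hsurj (by simp [Fintype.card_prod, ZMod.card])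
    (by simp [Fintype.card_prod, ZMod.card]) two_mul_addOrderOf_lt_z5_z140 h

/-- Every element of `ℤ₁₀ × ℤ₇₀` has order `≤ 70 < |A|/2`. [folklore] -/
theorem two_mul_addOrderOf_lt_z10_z70 (g : ZMod 10 × ZMod 70) : 2 * addOrderOf g < Fintype.card (ZMod 10 × ZMod 70) := by
  have h1 : addOrderOf g.1 ∣ 70 := (addOrderOf_dvd_card (x := g.1)).trans (by rw [ZMod.card]; norm_num)
  have h2 : addOrderOf g.2 ∣ 70 := (addOrderOf_dvd_card (x := g.2)).trans (by rw [ZMod.card])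
  have hle : addOrderOf g ≤ 70 := Nat.le_of_dvd (by norm_num) (by rw [Prod.addOrderOf]; exact Nat.lcm_dvd h1 h2)
  have hA : Fintype.card (ZMod 10 × ZMod 70) = 700 := by simp [Fintype.card_prod, ZMod.card]
  omega

/-- **`ℤ₁₀ × ℤ₇₀` (`|A| = 700`, = 3·233 + 1): no dihedral-like group over it (any `c₀`) has a TPP triple attaining
`3|S||T||U| + 8 = 8|A|`.** [folklore] -/
theorem no_mod_one_law_z10_z70 {ρ τ : ZMod 10 × ZMod 70 → G} {c₀ : ZMod 10 × ZMod 70}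
    (hρρ : ∀ a b, ρ a * ρ b = ρ (a + b)) (hρτ : ∀ a b, ρ a * τ b = τ (b - a))
    (hτρ : ∀ a b, τ a * ρ b = τ (a + b)) (hττ : ∀ a b, τ a * τ b = ρ (c₀ + b - a))
    (hρ : Function.Injective ρ) (hτ : Function.Injective τ) (hne : ∀ a b, ρ a ≠ τ b)
    (hsurj : ∀ g, (∃ a, ρ a = g) ∨ (∃ a, τ a = g)) (h : TripleProductProperty S T U) :
    3 * (S.card * T.card * U.card) + 8 ≠ 8 * Fintype.card (ZMod 10 × ZMod 70) :=
  no_mod_one_law_of_small_orders_prime (p := 233) (by norm_num) hρρ hρτ hτρ hττ hρ hτ hne hsurj (by simp [Fintype.card_prod, ZMod.card])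
    (by simp [Fintype.card_prod, ZMod.card]) two_mul_addOrderOf_lt_z10_z70 h

/-- Every element of `ℤ₅ × ℤ₁₇₀` has order `≤ 170 < |A|/2`. [folklore] -/
theorem two_mul_addOrderOf_lt_z5_z170 (g : ZMod 5 × ZMod 170) : 2 * addOrderOf g < Fintype.card (ZMod 5 × ZMod 170) := by
  have h1 : addOrderOf g.1 ∣ 170 := (addOrderOf_dvd_card (x := g.1)).trans (by rw [ZMod.card]; norm_num)
  have h2 : addOrderOf g.2 ∣ 170 := (addOrderOf_dvd_card (x := g.2)).trans (by rw [ZMod.card])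
  have hle : addOrderOf g ≤ 170 := Nat.le_of_dvd (by norm_num) (by rw [Prod.addOrderOf]; exact Nat.lcm_dvd h1 h2)
  have hA : Fintype.card (ZMod 5 × ZMod 170) = 850 := by simp [Fintype.card_prod, ZMod.card]
  omega

/-- **`ℤ₅ × ℤ₁₇₀` (`|A| = 850`, = 3·283 + 1): no dihedral-like group over it (any `c₀`) has a TPP triple attaining
`3|S||T||U| + 8 = 8|A|`.** [folklore] -/
theorem no_mod_one_law_z5_z170 {ρ τ : ZMod 5 × ZMod 170 → G} {c₀ : ZMod 5 × ZMod 170}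
    (hρρ : ∀ a b, ρ a * ρ b = ρ (a + b)) (hρτ : ∀ a b, ρ a * τ b = τ (b - a))
    (hτρ : ∀ a b, τ a * ρ b = τ (a + b)) (hττ : ∀ a b, τ a * τ b = ρ (c₀ + b - a))
    (hρ : Function.Injective ρ) (hτ : Function.Injective τ) (hne : ∀ a b, ρ a ≠ τ b)
    (hsurj : ∀ g, (∃ a, ρ a = g) ∨ (∃ a, τ a = g)) (h : TripleProductProperty S T U) :
    3 * (S.card * T.card * U.card) + 8 ≠ 8 * Fintype.card (ZMod 5 × ZMod 170) :=
  no_mod_one_law_of_small_orders_prime (p := 283) (by norm_num) hρρ hρτ hτρ hττ hρ hτ hne hsurj (by simp [Fintype.card_prod, ZMod.card])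
    (by simp [Fintype.card_prod, ZMod.card]) two_mul_addOrderOf_lt_z5_z170 h

end Instances

end Summit.MatrixMultiplication.OmegaCensus
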